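import Literature.NumberTheory.GaloisRepresentations.LubinTateColemanTraceKernelTwo
import HarnessLib

/-!
# `q = 2`: de Shalit's Lemma I.3.4 (ii) in coordinates — the `𝒪[F]ˣ`/Galois action on the coordinates `r_β`
# of the norm-coherent units: `r_{σ_v β} = v · ρ_v · (r_β ∘ [v]_f)`

De Shalit, *Iwasawa theory of elliptic curves with complex multiplication* (1987), Ch. I §3.4 Lemma (ii):
`μ_{σβ} = σμ_β`, i.e. the Coleman map `i : 𝒰 → Λ` is `Λ`-linear for the Galois action through `κ`.  On the
power-series side (`f = πX + X²` over `F` with `|𝓀_F| = 2`, `π = 2u`; coordinates `r_β` with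
`(δβ)~ = (1 + u⁻¹X)·(r_β ∘ f)`, `LubinTateColemanTraceKernelTwo.lean`) the action of `v ∈ 𝒪[F]ˣ ≅ G(K_π^∞/F)` is
`δ(σ_vβ) = v·(δβ) ∘ [v]_f` (`NormCoherentUnits.logDeriv_unitAct`); this file transports it to the coordinates:

* `ltSMul_ltDivPt_eq` — **`[a]_f ω_c = ω_{ā c}`** (any `q`); `ltSMul_unit_ltDivPt_one_two` — at `q = 2` a unit fixes
  `ω₁ = −π`;
* ★ `reflTwo_hom_two` — **`[v](−π − X) = −π − [v](X)`** (`[v](X [+] ω₁) = [v]X [+] [v]ω₁`), hence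
  `reflTwo_one_add_mul_hom_two` — `1 + t[v]` is reflection-ANTI-invariant (`2 = πt`);
* `unitTwistSerTwo hπ t v = (1 + t[v])·(1 + tX)⁻¹`, reflection invariant (`reflTwo_unitTwistSerTwo`), so a
  series in `f`: ★ `one_add_mul_subst_evenPartTwo_unitTwistSerTwo` — **`(1 + tX)·(ρ_v ∘ f) = 1 + t[v]_f`** with
  `ρ_v := evenPartTwo (unitTwistSerTwo)` (a unit of `𝒪[F]⟦Y⟧`);
* ★★★ `unitCoordTwo_unitAct` — **`r_{σ_v β} = v · ρ_v · (r_β ∘ [v]_f)`**, and `unitCoordTwo_galAct` — the same for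
  `σ ∈ Γ_F` through the Lubin–Tate character `χ_π`: the explicit SEMILINEAR action of `𝒪[F]ˣ` on the free
  rank-one coordinate module `{r ∈ 𝒪[F]⟦Y⟧}` that makes `β ↦ r_β` equivariant (Theorem I.3.7 with its
  `Λ`-structure, power-series form).

0 sorry, no named facts.

## References

* E. de Shalit, *Iwasawa theory of elliptic curves with complex multiplication* (1987), Ch. I §1.8, §3.4
  Lemma (ii), §3.7. [deShalit1987]
* J. Lubin, J. Tate, *Formal complex multiplication in local fields*, Ann. of Math. 81 (1965), §1. [LubinTate1965]
-/

noncomputable section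

open scoped PowerSeries.WithPiTopology

namespace Literature.NumberTheory.GaloisRepresentations
section LocalFieldE2

open GaloisRepresentations.IsNonarchimedeanLocalField LubinTate ValuativeRel

variable (F : Type*) [Field F] [ValuativeRel F] [TopologicalSpace F] [IsNonarchimedeanLocalField F]

attribute [local instance] ltNormUniformSpace ltNormIsUniformAddGroup rk1 nF nE fintypeResidueField

variable {F}
variable {π : 𝒪[F]} (hπ : (valuation F).IsUniformizer (π : F)) (n : ℕ)

/-- `f` is substitutable (`f(0) = 0`). [folklore] -/
private theorem hasSubst_ltSer₄ : PowerSeries.HasSubst (ltSer F π) :=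
  PowerSeries.HasSubst.of_constantCoeff_zero' (isLTSeries_ltSer π).constantCoeff_eq_zero

/-- `[v]_f` is substitutable (`[v](0) = 0`). [folklore] -/
private theorem hasSubst_hom₄ (v : LTCoeff F) :
    PowerSeries.HasSubst (hom (isLTRing_LTCoeff hπ) (isLTSeries_LTCoeff π) (isLTSeries_LTCoeff π) v) :=
  PowerSeries.HasSubst.of_constantCoeff_zero' (constantCoeff_hom _ _ _ v)

/-! ### `[a]_f` on the division points: `[a] ω_c = ω_{ā c}`; at `q = 2`, `[v] ω₁ = ω₁` for a unit `v` -/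

/-- **`[a] ω_c = ω_{ā c}`**: `[a]_f` acts on `W_f^1 ≅ 𝓀_F` through the residue `ā` (any `q`).
[cite: deShalit1987, Ch. I §1.8] -/
theorem ltSMul_ltDivPt_eq (a : 𝒪[F]) (c : 𝓀[F]) :
    ltSMul (maxNilIdeal F (ltField π n)) (isLTRing_LTCoeff hπ) (isLTSeries_LTCoeff π) (LTCoeff.of F a)
        (ltDivPt hπ n c) = ltDivPt hπ n (IsLocalRing.residue 𝒪[F] a * c) := by
  rw [ltDivPt, ltDivPt, ← mul_ltSMul, ← map_mul]
  refine ltSMul_genPt_eq_of_pow_dvd_sub hπ ?_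
  rw [← mul_assoc, mul_comm a, mul_assoc, ← mul_sub, pow_succ]
  refine mul_dvd_mul_left _ (dvd_of_mem_maximalIdeal F hπ ?_)
  rw [← IsLocalRing.residue_eq_zero_iff, map_sub, map_mul, residue_residueDigit, residue_residueDigit, sub_self]

/-- **At `q = 2` a unit fixes the non-zero division point: `[v] ω₁ = ω₁`.** [cite: deShalit1987, Ch. I §1.8] -/
theorem ltSMul_unit_ltDivPt_one_two (hq : residueFieldCard F = 2) (v : 𝒪[F]ˣ) :
    ltSMul (maxNilIdeal F (ltField π n)) (isLTRing_LTCoeff hπ) (isLTSeries_LTCoeff π) (LTCoeff.of F (v : 𝒪[F]))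
        (ltDivPt hπ n 1) = ltDivPt hπ n 1 := by
  rw [ltSMul_ltDivPt_eq, mul_one, eq_one_of_ne_zero_two hq ((IsLocalRing.residue_ne_zero_iff_isUnit _).mpr v.isUnit)]

/-! ### The reflection of `[v]_f`: `[v](−π − X) = −π − [v](X)` -/

/-- ★ **`[v](−π − X) = −π − [v](X)` for a unit `v` at `q = 2`**: the reflection anti-commutes with `[v]_f` up to
the constant (`[v](X [+] ω₁) = [v]X [+] [v]ω₁ = [v]X [+] ω₁`). [cite: deShalit1987, Ch. I §3.12] -/
theorem reflTwo_hom_two (hq : residueFieldCard F = 2) (v : 𝒪[F]ˣ) :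
    reflTwo hπ n (hom (isLTRing_LTCoeff hπ) (isLTSeries_LTCoeff π) (isLTSeries_LTCoeff π) (LTCoeff.of F (v : 𝒪[F]))) =
      -hom (isLTRing_LTCoeff hπ) (isLTSeries_LTCoeff π) (isLTSeries_LTCoeff π) (LTCoeff.of F (v : 𝒪[F])) -
        PowerSeries.C (LTCoeff.of F π) := by
  set S := unitBall (ltField π n)
  set M := maxNilIdeal F (ltField π n)
  refine PowerSeries.map_injective _ (algebraMap_LTCoeff_injective (ltField π n)) ?_
  have hpt : transl M (isLTRing_LTCoeff hπ) (isLTSeries_LTCoeff π) (ltDivPt hπ n 1)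
      (hom (isLTRing_LTCoeff hπ) (isLTSeries_LTCoeff π) (isLTSeries_LTCoeff π) (LTCoeff.of F (v : 𝒪[F]))) =
      ((ltSMul (seriesNilIdeal M) (isLTRing_LTCoeff hπ) (isLTSeries_LTCoeff π) (LTCoeff.of F (v : 𝒪[F]))
        (tPt M (isLTRing_LTCoeff hπ) (isLTSeries_LTCoeff π) (ltDivPt hπ n 1)) : (seriesNilIdeal M).toIdeal) :
          PowerSeries S) := by
    rw [transl, ltSMul, coe_evalPt₁_eq_evalAt]
  have hX : ((ltSMul (seriesNilIdeal M) (isLTRing_LTCoeff hπ) (isLTSeries_LTCoeff π) (LTCoeff.of F (v : 𝒪[F]))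
      (serX M) : (seriesNilIdeal M).toIdeal) : PowerSeries S) =
      (hom (isLTRing_LTCoeff hπ) (isLTSeries_LTCoeff π) (isLTSeries_LTCoeff π) (LTCoeff.of F (v : 𝒪[F]))).map
        (algebraMap (LTCoeff F) S) := by
    rw [ltSMul, coe_evalPt₁_eq_evalAt, evalAt_serX]
  rw [map_reflTwo hπ n hq, hpt, tPt, ltSMul_ltAdd, ← serC_ltSMul, ltSMul_unit_ltDivPt_one_two hπ n hq,
    ← evTPt_tPt, coe_evTPt, coe_tPt_ltDivPt_two hπ n hq one_ne_zero, map_sub, map_neg, evT_C, evT_X, hX,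
    map_sub, map_neg, PowerSeries.map_C]
  rfl

/-- `reflTwo (1 + t·[v]) = −(1 + t·[v])` when `2 = πt` (`v` a unit). [cite: deShalit1987, Ch. I §3.12] -/
theorem reflTwo_one_add_mul_hom_two (hq : residueFieldCard F = 2) {t : LTCoeff F}
    (ht : (2 : LTCoeff F) = LTCoeff.of F π * t) (v : 𝒪[F]ˣ) :
    reflTwo hπ n (1 + PowerSeries.C t *
        hom (isLTRing_LTCoeff hπ) (isLTSeries_LTCoeff π) (isLTSeries_LTCoeff π) (LTCoeff.of F (v : 𝒪[F]))) =
      -(1 + PowerSeries.C t *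
        hom (isLTRing_LTCoeff hπ) (isLTSeries_LTCoeff π) (isLTSeries_LTCoeff π) (LTCoeff.of F (v : 𝒪[F]))) := by
  rw [reflTwo_add hπ n hq, ← map_one PowerSeries.C, reflTwo_C hπ n hq, reflTwo_C_mul hπ n hq, reflTwo_hom_two hπ n hq,
    map_one]
  have h2 : PowerSeries.C t * PowerSeries.C (LTCoeff.of F π) = (2 : PowerSeries (LTCoeff F)) := by
    rw [← map_mul, mul_comm, ← ht, map_ofNat]
  linear_combination (-1 : PowerSeries (LTCoeff F)) * h2

/-! ### The twist `ρ_v`: `1 + t·[v] = (1 + tX) · (ρ_v ∘ f)` -/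

/-- The series `(1 + t·[v]_f) · (1 + tX)⁻¹`. [cite: deShalit1987, Ch. I §3.4] -/
def unitTwistSerTwo (t : LTCoeff F) (v : 𝒪[F]ˣ) : PowerSeries (LTCoeff F) :=
  (1 + PowerSeries.C t * hom (isLTRing_LTCoeff hπ) (isLTSeries_LTCoeff π) (isLTSeries_LTCoeff π)
    (LTCoeff.of F (v : 𝒪[F]))) * PowerSeries.invOfUnit (1 + PowerSeries.C t * PowerSeries.X) 1

/-- `(1 + tX) · unitTwistSerTwo = 1 + t·[v]`. [cite: deShalit1987, Ch. I §3.4] -/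
theorem one_add_mul_unitTwistSerTwo (t : LTCoeff F) (v : 𝒪[F]ˣ) :
    (1 + PowerSeries.C t * PowerSeries.X) * unitTwistSerTwo hπ t v =
      1 + PowerSeries.C t * hom (isLTRing_LTCoeff hπ) (isLTSeries_LTCoeff π) (isLTSeries_LTCoeff π)
        (LTCoeff.of F (v : 𝒪[F])) := by
  rw [unitTwistSerTwo, mul_left_comm, PowerSeries.mul_invOfUnit _ _ (by
    rw [map_add, map_one, map_mul, PowerSeries.constantCoeff_X, mul_zero, add_zero, Units.val_one]), mul_one]

/-- ★ **`unitTwistSerTwo` is reflection invariant** (quotient of two anti-invariant series). [cite: deShalit1987, Ch. I §3.4] -/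
theorem reflTwo_unitTwistSerTwo (hq : residueFieldCard F = 2) {t : LTCoeff F}
    (ht : (2 : LTCoeff F) = LTCoeff.of F π * t) (v : 𝒪[F]ˣ) :
    reflTwo hπ n (unitTwistSerTwo hπ t v) = unitTwistSerTwo hπ t v := by
  haveI : IsDomain (LTCoeff F) := inferInstanceAs (IsDomain 𝒪[F])
  have h1 := congrArg (reflTwo hπ n) (one_add_mul_unitTwistSerTwo hπ t v)
  rw [reflTwo_mul hπ n hq, reflTwo_one_add_mul_hom_two hπ n hq ht, ← one_add_mul_unitTwistSerTwo hπ t v,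
    reflTwo_add hπ n hq, ← map_one PowerSeries.C, reflTwo_C hπ n hq, reflTwo_C_mul hπ n hq, reflTwo_X hπ n hq,
    map_one] at h1
  have h2 : PowerSeries.C t * PowerSeries.C (LTCoeff.of F π) = (2 : PowerSeries (LTCoeff F)) := by
    rw [← map_mul, mul_comm, ← ht, map_ofNat]
  have h3 : (1 + PowerSeries.C t * PowerSeries.X) * (reflTwo hπ n (unitTwistSerTwo hπ t v) - unitTwistSerTwo hπ t v) = 0 := by
    linear_combination (-1 : PowerSeries (LTCoeff F)) * h1 - reflTwo hπ n (unitTwistSerTwo hπ t v) * h2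
  have hne : (1 + PowerSeries.C t * PowerSeries.X : PowerSeries (LTCoeff F)) ≠ 0 := fun h0 => by
    have := congrArg PowerSeries.constantCoeff h0
    rw [map_add, map_one, map_mul, PowerSeries.constantCoeff_X, mul_zero, add_zero, map_zero] at this
    exact one_ne_zero this
  exact sub_eq_zero.mp ((mul_eq_zero.mp h3).resolve_left hne)

include hπ in
/-- **The twist `ρ_v := evenPartTwo (unitTwistSerTwo)`** with ★ `(ρ_v ∘ f) · (1 + tX) = 1 + t·[v]_f`.
[cite: deShalit1987, Ch. I §3.4] -/
theorem one_add_mul_subst_evenPartTwo_unitTwistSerTwo (hq : residueFieldCard F = 2) {t : LTCoeff F}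
    (ht : (2 : LTCoeff F) = LTCoeff.of F π * t) (v : 𝒪[F]ˣ) :
    (1 + PowerSeries.C t * PowerSeries.X) *
        PowerSeries.subst (ltSer F π) (evenPartTwo hπ hq (unitTwistSerTwo hπ t v)) =
      1 + PowerSeries.C t * hom (isLTRing_LTCoeff hπ) (isLTSeries_LTCoeff π) (isLTSeries_LTCoeff π)
        (LTCoeff.of F (v : 𝒪[F])) := by
  have h0 : oddPartTwo hπ hq (unitTwistSerTwo hπ t v) = 0 :=
    (reflTwo_eq_self_iff_oddPartTwo_eq_zero hπ hq _).mp (reflTwo_unitTwistSerTwo hπ 0 hq ht v)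
  have h1 := eq_evenPartTwo_add_X_mul_oddPartTwo hπ hq (unitTwistSerTwo hπ t v)
  rw [h0, ← PowerSeries.coe_substAlgHom hasSubst_ltSer₄, map_zero, mul_zero, add_zero, PowerSeries.coe_substAlgHom] at h1
  rw [← h1, one_add_mul_unitTwistSerTwo]

/-! ### De Shalit's Lemma 3.4 (ii) in coordinates: `r_{σ_v β} = v · ρ_v · (r_β ∘ [v]_f)` -/

/-- ★★★ **The `𝒪[F]ˣ`-action on the coordinates** (`q = 2`, `π = 2u`, `t = u⁻¹`): for `v ∈ 𝒪[F]ˣ`,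
**`r_{σ_v β} = v · ρ_v · (r_β ∘ [v]_f)`** with `ρ_v = evenPartTwo (unitTwistSerTwo)` the unit series defined by
`(ρ_v ∘ f)(1 + tX) = 1 + t[v]_f` — the semilinear action making the free rank-one coordinate module `𝒪⟦Y⟧` into
the `Λ`-module `𝒰` (from `δ(σ_vβ) = v·(δβ) ∘ [v]`, `(h ∘ [v])~ = h̃ ∘ [v]`, `(r ∘ f) ∘ [v] = (r ∘ [v]) ∘ f` and
the uniqueness of the coordinate). [cite: deShalit1987, Ch. I §3.4 Lemma (ii)] -/
theorem unitCoordTwo_unitAct (hq : residueFieldCard F = 2) (u : (LTCoeff F)ˣ)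
    (hu : LTCoeff.of F π = residueFieldCard F * u) (v : 𝒪[F]ˣ) (β : NormCoherentUnits hπ) :
    unitCoordTwo hπ hq u (β.unitAct v) =
      PowerSeries.C (LTCoeff.of F (v : 𝒪[F])) * evenPartTwo hπ hq (unitTwistSerTwo hπ (↑u⁻¹ : LTCoeff F) v) *
        PowerSeries.subst (hom (isLTRing_LTCoeff hπ) (isLTSeries_LTCoeff π) (isLTSeries_LTCoeff π)
          (LTCoeff.of F (v : 𝒪[F]))) (unitCoordTwo hπ hq u β) := by
  have ht := two_eq_of_mul_inv hq u hu
  set t : LTCoeff F := ↑u⁻¹ with htdef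
  set H := hom (isLTRing_LTCoeff hπ) (isLTSeries_LTCoeff π) (isLTSeries_LTCoeff π) (LTCoeff.of F (v : 𝒪[F])) with hH
  have hsC : ∀ (a : LTCoeff F) (w : PowerSeries (LTCoeff F)) (hw : PowerSeries.HasSubst w),
      PowerSeries.subst w (PowerSeries.C a) = PowerSeries.C a := fun a w hw => by
    rw [← PowerSeries.coe_substAlgHom hw, PowerSeries.C_eq_algebraMap, AlgHom.commutes]
  have e1 : tildeSer π (u : LTCoeff F) (β.unitAct v).logDeriv =
      PowerSeries.C (LTCoeff.of F (v : 𝒪[F])) * PowerSeries.subst H (tildeSer π (u : LTCoeff F) β.logDeriv) := by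
    rw [NormCoherentUnits.logDeriv_unitAct, tildeSer_C_mul, tildeSer_subst_hom hπ]
  have e2 : PowerSeries.subst H (tildeSer π (u : LTCoeff F) β.logDeriv) =
      (1 + PowerSeries.C t * H) * PowerSeries.subst (ltSer F π) (PowerSeries.subst H (unitCoordTwo hπ hq u β)) := by
    rw [tildeSer_logDeriv_eq_unitCoordTwo hπ hq u hu β, ← PowerSeries.coe_substAlgHom (hasSubst_hom₄ hπ _), map_mul,
      map_add, map_one, map_mul, PowerSeries.coe_substAlgHom, hsC _ _ (hasSubst_hom₄ hπ _),
      PowerSeries.subst_X (hasSubst_hom₄ hπ _), hH, subst_hom_subst_ltSer hπ]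
  refine eq_of_one_add_mul_subst_eq_two hπ hq t ?_
  rw [← tildeSer_logDeriv_eq_unitCoordTwo hπ hq u hu, e1, e2, ← PowerSeries.coe_substAlgHom hasSubst_ltSer₄, map_mul,
    map_mul, PowerSeries.coe_substAlgHom, hsC _ _ hasSubst_ltSer₄, ← one_add_mul_subst_evenPartTwo_unitTwistSerTwo hπ hq ht v]
  ring

/-- ★★ **The Galois action on the coordinates**: `r_{σβ} = χ_π(σ) · ρ_{χ_π(σ)} · (r_β ∘ [χ_π(σ)]_f)` for `σ ∈ Γ_F`
(`χ_π` the Lubin–Tate character). [cite: deShalit1987, Ch. I §3.4 Lemma (ii)] -/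
theorem unitCoordTwo_galAct (hq : residueFieldCard F = 2) (u : (LTCoeff F)ˣ)
    (hu : LTCoeff.of F π = residueFieldCard F * u) (σ : Field.absoluteGaloisGroup F) (β : NormCoherentUnits hπ) :
    unitCoordTwo hπ hq u (β.galAct σ) =
      PowerSeries.C (LTCoeff.of F (lubinTateChar hπ σ : 𝒪[F])) *
        evenPartTwo hπ hq (unitTwistSerTwo hπ (↑u⁻¹ : LTCoeff F) (lubinTateChar hπ σ)) *
        PowerSeries.subst (hom (isLTRing_LTCoeff hπ) (isLTSeries_LTCoeff π) (isLTSeries_LTCoeff π)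
          (LTCoeff.of F (lubinTateChar hπ σ : 𝒪[F]))) (unitCoordTwo hπ hq u β) := by
  rw [NormCoherentUnits.galAct_eq_unitAct]
  exact unitCoordTwo_unitAct hπ hq u hu _ β

end LocalFieldE2

end Literature.NumberTheory.GaloisRepresentations
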